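import Mathlib
import Summits.KontsevichZagierPeriods.KontsevichZagierPeriods.Theorems.SoloInformedZetaFourStep
import HarnessLib
import HarnessLib.Audit

/-!
# SoloInformed — the depth-2 telescope step AT EVERY WEIGHT (PROGRAMME XXXIX, file 1)

Solo programme `solo-KontsevichZagierPeriods-informed`, session s46. The generic Möbius telescope
step (`SoloInformedTelDatum.telescope`, PART XVI) instantiated in dimension `m + 4` (weight `n ≥ 4`)
with active coordinate `x₀`, `Q = x₁ ⋯ x_{m+2}` (the MIDDLE coordinates), `ω = x_{m+3}` (the last
coordinate), `C = 1`, cylinder `D = (0,1)^{m+4}`: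

  `[(0,1)ⁿ ∩ {x_{n-1} < x₀}, 1/((1 − x₀x₁⋯x_{n-2})(1 − x_{n-1}))]`
    `− [(0,1)ⁿ, 1/((1 − x₀⋯x_{n-2})(1 − x₀⋯x_{n-2}x_{n-1}))] ∈ KZ.relations`   (`n = m + 4`).

The left side is the Yamamoto integral of the garland poset "chain of `n − 1` plus one pendant
below the top" (it dissects, by the order-cell engine THM XXXVIII, into
`2 Z(n−1,1) + Σ_{j=2}^{n−2} Z(n−j,j)`), the right side is `ζ⋆(n−1,1) = ζ(n−1,1) + ζ(n)` in cubical
coordinates; together they give the depth-2 sum formula `Σ_{j=1}^{n−2} ζ(n−j,j) = ζ(n)` in `𝒫`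
(files 2–5 of the programme). This file is the analytic input, uniform in the weight: both
integrands are dominated by the integrable weight `∏ᵢ (1 − xᵢ)^{−1/2}` (only the four coordinates
`0, 1, 2, n−1` are used, which is why `n ≥ 4`; weight 3 is Euler's `ζ(2,1) = ζ(3)`,
`soloInformed_mzvClass_euler3`, weight 4 is `soloInformedZ4Datum`).

References: Kontsevich–Zagier 2001 §1.2 [KontsevichZagier2001]; S. Yamamoto, arXiv:1405.6499;
the value identity is Euler's / Granville–Zagier's sum formula in depth 2
(`multipleZeta_sum_formula_depth_two` in the Literature).
-/

noncomputable section

open MeasureTheory Set MvPolynomial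
open Literature.ModelTheory.ExponentialFields Literature.NumberTheory.Transcendental
open Literature.NumberTheory.Transcendental.KZ

namespace Summit.KontsevichZagierPeriods.KontsevichZagierPeriods.Theorems

variable {m : ℕ}

/-! ## 1. The middle coordinates, `Q` and `ω` -/

/-- The MIDDLE coordinates `{1, …, m+2}` of `Fin (m+4)`: all but `0` and the last one. -/
def soloInformedMid (m : ℕ) : Finset (Fin (m + 4)) :=
  Finset.univ.filter fun j => j ≠ 0 ∧ j ≠ Fin.last (m + 3)

/-- `Q = X₁ X₂ ⋯ X_{m+2}`. -/
def soloInformedSumQ (m : ℕ) : MvPolynomial (Fin (m + 4)) ℚ := ∏ j ∈ soloInformedMid m, X j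

/-- `ω = X_{m+3}`. -/
def soloInformedSumΩ (m : ℕ) : MvPolynomial (Fin (m + 4)) ℚ := X (Fin.last (m + 3))

/-- The middle product `q(x) = x₁ ⋯ x_{m+2}`. -/
def soloInformedMidProd (x : Fin (m + 4) → ℝ) : ℝ := ∏ j ∈ soloInformedMid m, x j

/-- Auxiliary (sum datum): evaluation of `Q`. -/
@[simp] theorem soloInformed_aeval_sumQ (x : Fin (m + 4) → ℝ) :
    (aeval x (soloInformedSumQ m) : ℝ) = soloInformedMidProd x := by
  simp [soloInformedSumQ, soloInformedMidProd, map_prod]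

/-- Auxiliary (sum datum): evaluation of `ω`. -/
@[simp] theorem soloInformed_aeval_sumΩ (x : Fin (m + 4) → ℝ) :
    (aeval x (soloInformedSumΩ m) : ℝ) = x (Fin.last (m + 3)) := by
  simp [soloInformedSumΩ]

/-- Auxiliary (sum datum): `0` is not a middle coordinate. -/
theorem soloInformed_zero_notMem_mid : (0 : Fin (m + 4)) ∉ soloInformedMid m := by
  simp [soloInformedMid]

/-- Auxiliary (sum datum): the last coordinate is not a middle coordinate. -/
theorem soloInformed_last_notMem_mid : Fin.last (m + 3) ∉ soloInformedMid m := by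
  simp [soloInformedMid]

/-- Auxiliary (sum datum): `1` is a middle coordinate. -/
theorem soloInformed_one_mem_mid : (1 : Fin (m + 4)) ∈ soloInformedMid m := by
  simp only [soloInformedMid, Finset.mem_filter, Finset.mem_univ, true_and, ne_eq, Fin.ext_iff,
    Fin.val_one, Fin.val_zero, Fin.val_last]
  omega

/-- Auxiliary (sum datum): `2` is a middle coordinate. -/
theorem soloInformed_two_mem_mid : (2 : Fin (m + 4)) ∈ soloInformedMid m := by
  simp only [soloInformedMid, Finset.mem_filter, Finset.mem_univ, true_and, ne_eq, Fin.ext_iff,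
    Fin.val_two, Fin.val_zero, Fin.val_last]
  omega

/-- Auxiliary (sum datum): `0, 1, 2, last` are pairwise distinct in `Fin (m+4)`. -/
theorem soloInformed_fin_ne : (0 : Fin (m + 4)) ≠ 1 ∧ (0 : Fin (m + 4)) ≠ 2 ∧
    (0 : Fin (m + 4)) ≠ Fin.last (m + 3) ∧ (1 : Fin (m + 4)) ≠ 2 ∧
    (1 : Fin (m + 4)) ≠ Fin.last (m + 3) ∧ (2 : Fin (m + 4)) ≠ Fin.last (m + 3) := by
  simp only [ne_eq, Fin.ext_iff, Fin.val_zero, Fin.val_one, Fin.val_two, Fin.val_last]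
  omega

/-! ## 2. Bounds on the cube -/

section bounds

variable {x : Fin (m + 4) → ℝ} (hx : x ∈ soloInformedOpenCube (m + 4))
include hx

/-- `0 < q`. -/
theorem soloInformed_midProd_pos : 0 < soloInformedMidProd x :=
  Finset.prod_pos fun j _ => (hx j).1

/-- `q ≤ x₁ x₂` (drop the factors `x₃, …, x_{m+2} ≤ 1`). -/
theorem soloInformed_midProd_le : soloInformedMidProd x ≤ x 1 * x 2 := by
  have h12 : (1 : Fin (m + 4)) ≠ 2 := (soloInformed_fin_ne (m := m)).2.2.2.1
  have h2 : (2 : Fin (m + 4)) ∈ (soloInformedMid m).erase 1 :=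
    Finset.mem_erase.2 ⟨h12.symm, soloInformed_two_mem_mid⟩
  unfold soloInformedMidProd
  rw [← Finset.mul_prod_erase _ _ soloInformed_one_mem_mid, ← Finset.mul_prod_erase _ _ h2, ← mul_assoc]
  refine mul_le_of_le_one_right (mul_nonneg (hx 1).1.le (hx 2).1.le) ?_
  exact Finset.prod_le_one (fun j _ => (hx j).1.le) fun j _ => (hx j).2.le

/-- `q ≤ 1`. -/
theorem soloInformed_midProd_le_one : soloInformedMidProd x ≤ 1 :=
  Finset.prod_le_one (fun j _ => (hx j).1.le) fun j _ => (hx j).2.le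

/-- `q x₀ ≤ x₁ x₂`. -/
theorem soloInformed_midProd_mul_le : soloInformedMidProd x * x 0 ≤ x 1 * x 2 :=
  (mul_le_of_le_one_right (soloInformed_midProd_pos hx).le (hx 0).2.le).trans
    (soloInformed_midProd_le hx)

/-- `q x₀ x_last ≤ x₀ x_last`. -/
theorem soloInformed_midProd_mul_mul_le :
    soloInformedMidProd x * x 0 * x (Fin.last (m + 3)) ≤ x 0 * x (Fin.last (m + 3)) := by
  rw [mul_assoc]
  exact mul_le_of_le_one_left (mul_nonneg (hx 0).1.le (hx _).1.le) (soloInformed_midProd_le_one hx)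

/-- `0 < 1 − q x₀`. -/
theorem soloInformed_sum_one_sub_pos : 0 < 1 - soloInformedMidProd x * x 0 := by
  have := soloInformed_midProd_mul_le hx
  nlinarith [mul_lt_one_of_nonneg_of_lt_one_left (hx 1).1.le (hx 1).2 (hx 2).2.le, (hx 2).1]

/-- `0 < 1 − q x₀ x_last`. -/
theorem soloInformed_sum_one_sub_pos' : 0 < 1 - soloInformedMidProd x * x 0 * x (Fin.last (m + 3)) := by
  have := soloInformed_midProd_mul_mul_le hx
  nlinarith [mul_lt_one_of_nonneg_of_lt_one_left (hx 0).1.le (hx 0).2 (hx (Fin.last (m + 3))).2.le]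

/-- The half weight factors `(1 − xⱼ)^{−1/2} ≥ 1`. -/
theorem soloInformed_one_le_half (j : Fin (m + 4)) : 1 ≤ (1 - x j) ^ (-(1 / 2 : ℝ)) :=
  Real.one_le_rpow_of_pos_of_le_one_of_nonpos (by linarith [(hx j).2]) (by linarith [(hx j).1])
    (by norm_num)

/-- **Four half factors are dominated by the full half weight**:
`(1−x₀)^{−1/2}(1−x₁)^{−1/2}(1−x₂)^{−1/2}(1−x_last)^{−1/2} ≤ ∏ⱼ (1−xⱼ)^{−1/2}`. -/
theorem soloInformed_four_le_W :
    (1 - x 0) ^ (-(1 / 2 : ℝ)) * (1 - x 1) ^ (-(1 / 2 : ℝ)) * (1 - x 2) ^ (-(1 / 2 : ℝ)) *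
      (1 - x (Fin.last (m + 3))) ^ (-(1 / 2 : ℝ)) ≤ soloInformedW (fun _ => 1 / 2) x := by
  obtain ⟨h01, h02, h0l, h12, h1l, h2l⟩ := soloInformed_fin_ne (m := m)
  have hA : ∏ j ∈ ({0, 1, 2, Fin.last (m + 3)} : Finset (Fin (m + 4))), (1 - x j) ^ (-(1 / 2 : ℝ)) =
      (1 - x 0) ^ (-(1 / 2 : ℝ)) * (1 - x 1) ^ (-(1 / 2 : ℝ)) * (1 - x 2) ^ (-(1 / 2 : ℝ)) *
        (1 - x (Fin.last (m + 3))) ^ (-(1 / 2 : ℝ)) := by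
    rw [Finset.prod_insert (by simp [h01, h02, h0l]), Finset.prod_insert (by simp [h12, h1l]),
      Finset.prod_pair h2l]; ring
  have hc : 1 ≤ ∏ j ∈ ({0, 1, 2, Fin.last (m + 3)} : Finset (Fin (m + 4)))ᶜ, (1 - x j) ^ (-(1 / 2 : ℝ)) := by
    have := Finset.prod_le_prod (s := ({0, 1, 2, Fin.last (m + 3)} : Finset (Fin (m + 4)))ᶜ)
      (f := fun _ => (1 : ℝ)) (g := fun j => (1 - x j) ^ (-(1 / 2 : ℝ)))
      (fun j _ => zero_le_one) fun j _ => soloInformed_one_le_half hx j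
    rwa [Finset.prod_const_one] at this
  have hApos : 0 ≤ ∏ j ∈ ({0, 1, 2, Fin.last (m + 3)} : Finset (Fin (m + 4))), (1 - x j) ^ (-(1 / 2 : ℝ)) :=
    Finset.prod_nonneg fun j _ => Real.rpow_nonneg (by linarith [(hx j).2]) _
  have hW : soloInformedW (fun _ => 1 / 2) x = ∏ j, (1 - x j) ^ (-(1 / 2 : ℝ)) := rfl
  rw [hW, ← Finset.prod_mul_prod_compl ({0, 1, 2, Fin.last (m + 3)} : Finset (Fin (m + 4))), ← hA]
  exact le_mul_of_one_le_right hApos hc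

/-- `1/(1 − q x₀) ≤ (1−x₁)^{−1/2} (1−x₂)^{−1/2}`. -/
theorem soloInformed_sum_bound_Q :
    1 / (1 - soloInformedMidProd x * x 0) ≤ (1 - x 1) ^ (-(1 / 2 : ℝ)) * (1 - x 2) ^ (-(1 / 2 : ℝ)) := by
  have h1 := hx 1; have h2 := hx 2
  have hp := soloInformed_one_div_one_sub_mul_le (α := 1 / 2) (β := 1 / 2) h1.1.le h1.2 h2.1.le
    h2.2 (by norm_num) (by norm_num) (by norm_num)
  refine (one_div_le_one_div_of_le (by nlinarith [mul_pos h1.1 h2.1]) ?_).trans hp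
  linarith [soloInformed_midProd_mul_le hx]

/-- `1/(1 − q x₀ x_last) ≤ (1−x₀)^{−1/2} (1−x_last)^{−1/2}`. -/
theorem soloInformed_sum_bound_Qω :
    1 / (1 - soloInformedMidProd x * x 0 * x (Fin.last (m + 3))) ≤
      (1 - x 0) ^ (-(1 / 2 : ℝ)) * (1 - x (Fin.last (m + 3))) ^ (-(1 / 2 : ℝ)) := by
  have h0 := hx 0; have hl := hx (Fin.last (m + 3))
  have hp := soloInformed_one_div_one_sub_mul_le (α := 1 / 2) (β := 1 / 2) h0.1.le h0.2 hl.1.le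
    hl.2 (by norm_num) (by norm_num) (by norm_num)
  refine (one_div_le_one_div_of_le (by nlinarith [mul_pos h0.1 hl.1]) ?_).trans hp
  linarith [soloInformed_midProd_mul_mul_le hx]

omit hx in
/-- `1/(1 − x_last) ≤ (1−x_last)^{−1/2} (1−x₀)^{−1/2}` on `{x_last < x₀}`. -/
theorem soloInformed_sum_bound_ω (hx : x ∈ soloInformedOpenCube (m + 4)) (hl0 : x (Fin.last (m + 3)) < x 0) :
    1 / (1 - x (Fin.last (m + 3))) ≤
      (1 - x (Fin.last (m + 3))) ^ (-(1 / 2 : ℝ)) * (1 - x 0) ^ (-(1 / 2 : ℝ)) := by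
  have h0 := hx 0; have hl := hx (Fin.last (m + 3))
  have hsplit : 1 / (1 - x (Fin.last (m + 3))) = (1 - x (Fin.last (m + 3))) ^ (-(1 / 2 : ℝ)) *
      (1 - x (Fin.last (m + 3))) ^ (-(1 / 2 : ℝ)) := by
    rw [soloInformed_one_div_eq_rpow_neg_one hl.2, ← soloInformed_rpow_neg_add hl.2]; norm_num
  rw [hsplit]
  exact mul_le_mul_of_nonneg_left (soloInformed_rpow_neg_antitone h0.2 hl0.le (by norm_num))
    (Real.rpow_nonneg (by linarith) _)

end bounds

/-! ## 3. The integrands and their domination -/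

/-- `f₁ = 1/((1 − q x₀)(1 − x_last))`. -/
theorem soloInformed_sumF1_eq (x : Fin (m + 4) → ℝ) :
    soloInformedStepF1 0 (soloInformedSumQ m) (soloInformedSumΩ m) 1 x =
      1 / ((1 - soloInformedMidProd x * x 0) * (1 - x (Fin.last (m + 3)))) := by
  simp [soloInformedStepF1]

/-- `S = 1/((1 − q x₀)(1 − q x₀ x_last))`. -/
theorem soloInformed_sumFS_eq (x : Fin (m + 4) → ℝ) :
    soloInformedStepFS 0 (soloInformedSumQ m) (soloInformedSumΩ m) 1 x =
      1 / ((1 - soloInformedMidProd x * x 0) *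
        (1 - soloInformedMidProd x * x 0 * x (Fin.last (m + 3)))) := by
  simp [soloInformedStepFS]

/-- **Domination of `f₁` on `{x_last < x₀}`** by the half weight. -/
theorem soloInformed_sumF1_le_W {x : Fin (m + 4) → ℝ} (hx : x ∈ soloInformedOpenCube (m + 4))
    (hl0 : x (Fin.last (m + 3)) < x 0) :
    1 / ((1 - soloInformedMidProd x * x 0) * (1 - x (Fin.last (m + 3)))) ≤
      soloInformedW (fun _ => 1 / 2) x := by
  have hA := soloInformed_sum_bound_Q hx
  have hB := soloInformed_sum_bound_ω hx hl0
  have hnn : 0 ≤ (1 - x 1) ^ (-(1 / 2 : ℝ)) * (1 - x 2) ^ (-(1 / 2 : ℝ)) :=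
    mul_nonneg (Real.rpow_nonneg (by linarith [(hx 1).2]) _) (Real.rpow_nonneg (by linarith [(hx 2).2]) _)
  calc 1 / ((1 - soloInformedMidProd x * x 0) * (1 - x (Fin.last (m + 3))))
        = 1 / (1 - soloInformedMidProd x * x 0) * (1 / (1 - x (Fin.last (m + 3)))) := by
        rw [one_div_mul_one_div]
    _ ≤ (1 - x 1) ^ (-(1 / 2 : ℝ)) * (1 - x 2) ^ (-(1 / 2 : ℝ)) *
        ((1 - x (Fin.last (m + 3))) ^ (-(1 / 2 : ℝ)) * (1 - x 0) ^ (-(1 / 2 : ℝ))) :=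
        mul_le_mul hA hB (one_div_pos.2 (by linarith [(hx (Fin.last (m + 3))).2])).le hnn
    _ = (1 - x 0) ^ (-(1 / 2 : ℝ)) * (1 - x 1) ^ (-(1 / 2 : ℝ)) * (1 - x 2) ^ (-(1 / 2 : ℝ)) *
        (1 - x (Fin.last (m + 3))) ^ (-(1 / 2 : ℝ)) := by ring
    _ ≤ soloInformedW (fun _ => 1 / 2) x := soloInformed_four_le_W hx

/-- **Domination of `S`** by the half weight. -/
theorem soloInformed_sumFS_le_W {x : Fin (m + 4) → ℝ} (hx : x ∈ soloInformedOpenCube (m + 4)) :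
    1 / ((1 - soloInformedMidProd x * x 0) * (1 - soloInformedMidProd x * x 0 * x (Fin.last (m + 3))))
      ≤ soloInformedW (fun _ => 1 / 2) x := by
  have hA := soloInformed_sum_bound_Q hx
  have hB := soloInformed_sum_bound_Qω hx
  have hnn : 0 ≤ (1 - x 1) ^ (-(1 / 2 : ℝ)) * (1 - x 2) ^ (-(1 / 2 : ℝ)) :=
    mul_nonneg (Real.rpow_nonneg (by linarith [(hx 1).2]) _) (Real.rpow_nonneg (by linarith [(hx 2).2]) _)
  calc 1 / ((1 - soloInformedMidProd x * x 0) *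
          (1 - soloInformedMidProd x * x 0 * x (Fin.last (m + 3))))
        = 1 / (1 - soloInformedMidProd x * x 0) *
          (1 / (1 - soloInformedMidProd x * x 0 * x (Fin.last (m + 3)))) := by
        rw [one_div_mul_one_div]
    _ ≤ (1 - x 1) ^ (-(1 / 2 : ℝ)) * (1 - x 2) ^ (-(1 / 2 : ℝ)) *
        ((1 - x 0) ^ (-(1 / 2 : ℝ)) * (1 - x (Fin.last (m + 3))) ^ (-(1 / 2 : ℝ))) :=
        mul_le_mul hA hB (one_div_pos.2 (soloInformed_sum_one_sub_pos' hx)).le hnn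
    _ = (1 - x 0) ^ (-(1 / 2 : ℝ)) * (1 - x 1) ^ (-(1 / 2 : ℝ)) * (1 - x 2) ^ (-(1 / 2 : ℝ)) *
        (1 - x (Fin.last (m + 3))) ^ (-(1 / 2 : ℝ)) := by ring
    _ ≤ soloInformedW (fun _ => 1 / 2) x := soloInformed_four_le_W hx

/-- The domain of the left side: `(0,1)ⁿ ∩ {x_last < x₀}`. -/
theorem soloInformed_sumD1_eq :
    soloInformedOpenCube (m + 4) ∩ {x : Fin (m + 4) → ℝ | (aeval x (soloInformedSumΩ m) : ℝ) < x 0}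
      = soloInformedOpenCube (m + 4) ∩ {x | x (Fin.last (m + 3)) < x 0} := by
  ext x; simp

/-- Measurability of that domain. -/
theorem soloInformed_measurableSet_sumD1 :
    MeasurableSet (soloInformedOpenCube (m + 4) ∩ {x : Fin (m + 4) → ℝ | x (Fin.last (m + 3)) < x 0}) :=
  (soloInformed_measurableSet_openCube _).inter
    (measurableSet_lt (measurable_pi_apply _) (measurable_pi_apply _))

/-- Integrability of `f₁` on `(0,1)ⁿ ∩ {x_last < x₀}`. -/
theorem soloInformed_integrableOn_sumF1 :
    IntegrableOn (soloInformedStepF1 0 (soloInformedSumQ m) (soloInformedSumΩ m) 1)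
      (soloInformedOpenCube (m + 4) ∩
        {x : Fin (m + 4) → ℝ | (aeval x (soloInformedSumΩ m) : ℝ) < x 0}) := by
  rw [soloInformed_sumD1_eq]
  refine soloInformed_integrableOn_of_le_W soloInformed_measurableSet_sumD1 inter_subset_left
    (soloInformed_continuousOn_stepF1 0 _ _ _ fun x hx => ?_) (fun _ => 1 / 2)
    (fun _ => by norm_num) 1 fun x hx => ?_
  · have h := soloInformed_sum_one_sub_pos hx.1
    have hl := hx.1 (Fin.last (m + 3))
    simpa using (mul_pos h (by linarith : (0:ℝ) < 1 - x (Fin.last (m + 3)))).ne'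
  · rw [soloInformed_sumF1_eq, one_mul, abs_of_pos (one_div_pos.2 (mul_pos
      (soloInformed_sum_one_sub_pos hx.1) (by linarith [(hx.1 (Fin.last (m + 3))).2])))]
    exact soloInformed_sumF1_le_W hx.1 hx.2

/-- Integrability of `S` on `(0,1)ⁿ`. -/
theorem soloInformed_integrableOn_sumFS :
    IntegrableOn (soloInformedStepFS 0 (soloInformedSumQ m) (soloInformedSumΩ m) 1)
      (soloInformedOpenCube (m + 4)) := by
  refine soloInformed_integrableOn_of_le_W (soloInformed_measurableSet_openCube _) subset_rfl
    (soloInformed_continuousOn_stepFS 0 _ _ _ fun x hx => ?_) (fun _ => 1 / 2)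
    (fun _ => by norm_num) 1 fun x hx => ?_
  · simpa using (mul_pos (soloInformed_sum_one_sub_pos hx) (soloInformed_sum_one_sub_pos' hx)).ne'
  · rw [soloInformed_sumFS_eq, one_mul, abs_of_pos (one_div_pos.2 (mul_pos
      (soloInformed_sum_one_sub_pos hx) (soloInformed_sum_one_sub_pos' hx)))]
    exact soloInformed_sumFS_le_W hx

/-! ## 4. The datum and the telescope identity -/

/-- **The depth-2 sum-formula telescope datum in weight `m + 4`**:
`(i, Q, ω, C, D) = (0, X₁⋯X_{m+2}, X_{m+3}, 1, (0,1)^{m+4})`. -/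
def soloInformedSumDatum (m : ℕ) : SoloInformedTelDatum (m + 4) where
  i := 0
  Q := soloInformedSumQ m
  Ω := soloInformedSumΩ m
  C := 1
  D := soloInformedOpenCube (m + 4)
  isSemialgebraic_D := isSemialgebraic_soloInformedOpenCube _
  measurableSet_D := soloInformed_measurableSet_openCube _
  update_mem := fun x hx t ht0 ht1 j => by
    by_cases hj : j = 0
    · subst hj; simpa using ⟨ht0, ht1⟩
    · rw [Function.update_of_ne hj]; exact hx j
  mem_Ioo := fun x hx => hx 0
  vars_Q := soloInformed_notMem_vars_prod_X soloInformed_zero_notMem_mid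
  vars_Ω := by
    have h : (0 : Fin (m + 4)) ≠ Fin.last (m + 3) := (soloInformed_fin_ne (m := m)).2.2.1
    simp [soloInformedSumΩ, vars_X, h]
  vars_C := by simp [vars_one]
  Q_bound := fun x hx => by
    rw [soloInformed_aeval_sumQ]
    refine ⟨(soloInformed_midProd_pos hx).le, (soloInformed_midProd_le hx).trans_lt ?_⟩
    exact mul_lt_one_of_nonneg_of_lt_one_left (hx 1).1.le (hx 1).2 (hx 2).2.le
  Ω_bound := fun x hx => by simpa using hx (Fin.last (m + 3))
  C_pos := fun x _ => by simp
  integrableOn_F1 := soloInformed_integrableOn_sumF1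
  integrableOn_FS := soloInformed_integrableOn_sumFS

/-- **THE DEPTH-2 TELESCOPE STEP AT EVERY WEIGHT `n = m + 4` (KERNEL):**
`[(0,1)ⁿ ∩ {x_{n−1} < x₀}, 1/((1 − x₀x₁⋯x_{n−2})(1 − x_{n−1}))]`
`− [(0,1)ⁿ, 1/((1 − x₀⋯x_{n−2})(1 − x₀⋯x_{n−2}x_{n−1}))] ∈ relations`. -/
theorem soloInformed_sum_telescope (m : ℕ) :
    of (soloInformedSumDatum m).R1 - of (soloInformedSumDatum m).R2 ∈ relations :=
  (soloInformedSumDatum m).telescope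

/-- Auxiliary (sum datum): `soloInformedSumDatum_i`. -/
@[simp] theorem soloInformedSumDatum_i : (soloInformedSumDatum m).i = 0 := rfl
/-- Auxiliary (sum datum): `soloInformedSumDatum_D`. -/
@[simp] theorem soloInformedSumDatum_D : (soloInformedSumDatum m).D = soloInformedOpenCube (m + 4) := rfl
/-- Auxiliary (sum datum): `soloInformedSumDatum_Q`. -/
@[simp] theorem soloInformedSumDatum_Q : (soloInformedSumDatum m).Q = soloInformedSumQ m := rfl
/-- Auxiliary (sum datum): `soloInformedSumDatum_Ω`. -/
@[simp] theorem soloInformedSumDatum_Ω : (soloInformedSumDatum m).Ω = soloInformedSumΩ m := rfl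
/-- Auxiliary (sum datum): `soloInformedSumDatum_C`. -/
@[simp] theorem soloInformedSumDatum_C : (soloInformedSumDatum m).C = 1 := rfl

/-- The domain of `R₁`: `(0,1)ⁿ ∩ {x_{n−1} < x₀}`. -/
theorem soloInformedSum_R1_domain : (soloInformedSumDatum m).R1.domain =
    soloInformedOpenCube (m + 4) ∩ {x | x (Fin.last (m + 3)) < x 0} := by
  rw [SoloInformedTelDatum.R1_domain]; ext x; simp [SoloInformedTelDatum.ω]

/-- The integrand of `R₁`: `1/((1 − x₁⋯x_{n−2}·x₀)(1 − x_{n−1}))`. -/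
theorem soloInformedSum_R1_integrand (x : Fin (m + 4) → ℝ) : (soloInformedSumDatum m).R1.integrand x =
    1 / ((1 - soloInformedMidProd x * x 0) * (1 - x (Fin.last (m + 3)))) := by
  rw [SoloInformedTelDatum.R1_integrand]; exact soloInformed_sumF1_eq x

/-- The domain of `R₂`: `(0,1)ⁿ`. -/
theorem soloInformedSum_R2_domain : (soloInformedSumDatum m).R2.domain = soloInformedOpenCube (m + 4) := rfl

/-- The integrand of `R₂`: `1/((1 − x₁⋯x_{n−2}·x₀)(1 − x₁⋯x_{n−2}·x₀·x_{n−1}))`. -/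
theorem soloInformedSum_R2_integrand (x : Fin (m + 4) → ℝ) : (soloInformedSumDatum m).R2.integrand x =
    1 / ((1 - soloInformedMidProd x * x 0) *
      (1 - soloInformedMidProd x * x 0 * x (Fin.last (m + 3)))) := by
  rw [SoloInformedTelDatum.R2_integrand]; exact soloInformed_sumFS_eq x

end Summit.KontsevichZagierPeriods.KontsevichZagierPeriods.Theorems
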